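import Mathlib
import HarnessLib
import Summits.HubbardSuperconductivity.HubbardSuperconductivity.Theorems.KLProgrammeKLRegimeEngineTowerWtLawBaseTokXSix
import Summits.HubbardSuperconductivity.HubbardSuperconductivity.Theorems.KLProgrammeKLRegimeEngineTowerWtLawOfBlocksKlEngUnif
import Summits.HubbardSuperconductivity.HubbardSuperconductivity.Theorems.KLProgrammeKLRegimeEngineSixLegImportByJumpWt
import Summits.HubbardSuperconductivity.HubbardSuperconductivity.Theorems.KLProgrammeKLRegimeEngineTowerWtReadoutRo

/-!
# ♯5 «6LEG-INSIDE», FILE G2: THE ONE-TRACK WEIGHTED TOWER LAW ON `K_n` WITH LINK, Z-THREAD, BRIDGE, BLOCK-1 PROFILE AND NOW THE SIX-LEG SIDE DISCHARGED —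
# NO SIX-LEG IMPORT ROW: the six-leg measured datum of block 1 is read off the base law, that of every block `k ≥ 2` off the SECTORISED six-leg cell of the
# previous input refined to the input family (k3c2-p3's reader) plus the law's own `p = 3` born row one block back under ONE weighted jump (p4's uniform row)
# Route `KLProgramme` — crux K3 ENGINE (stmt-HubbardSuperconductivity-20437 `KLRegimeEngineV17F2`), stub (b) v2, THE WEIGHTED HALF «(b)-WT4»
# (cell gate-hubbard-kl, seat hubbard-kl-k3c3-p2 g18; = ♯4 file A `klTowerBornWtAt_le_law_of_blocks_klEng_tokX_unif` with W1 replaced by G1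
#  `klTowerBornWtAt_le_law_of_inputs_base_tokX_six`, W3b's bridge inlined, and the six-leg bridge `hR3` DISCHARGED from
#  `klWtPinnedSumOf_six_klTowerInput_jump_le_budget_klEng_flow_all` (k3c2-p3 g17, p713096) + `klWtPinnedSumAt_klTowerIncr_remeasure_le_klEng_flow_all_uniform` (p4 g17)
#  + `jumpW_mul_div_klLevUnitF_le` (W6); located finding «(b)-WT4-6LEG-CURRENCY» k3c2-p3 g17 KL STATUS l.12210 / T2-2 l.12218 / pen (R416); «D-ORDER» kept cured)

THE SIX-LEG MECHANISM (why no import and no logarithm).  At block `k ≥ 2` the input is `𝒱_{dk} = 𝒱_{d(k−1)} + Δ_{k−1}` (`klTowerInput_succ`); at the input family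
`F_{dk−1}` and rate `j ≥ d·K_b ≥ dk`:
* `𝒱_{d(k−1)}`: anti-rate to the tied sum (`klWtPinnedSumAt_le_klWtPinnedSumOf`), then k3c2-p3's refinement reader from the SECTORISED cell at level `d(k−1)`
  (`d(k−1) + 1 ≤ dk − 1` iff `d ≥ 2`): `≤ C₆·klWtBudget P Qe U (dk−1) 6 = C₆·CE³·ε_{dk−1}²·2^{4(dk−1)}`; in floor units (`klLevUnitF β M 0 3 J = ε_x⁵·2^{4J}`, §-lemma
  `hunit6` inside) this is `C₆·CE³·ε_{dk−1}²/ε_x⁵ ≤ C₆·CE³·λ²/ε_x⁵` (`ε_{dk−1} ≤ ε_j ≤ λ`, the new floor binder);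
* `Δ_{k−1}`: p4's m-uniform weighted jump at `m + 1 = 6` from the born array at `F_{d(k−1)}` (`C₁j·C₂j⁵·(2^{d−1})⁴`), and `(2^{d−1})⁴·X/unitF(3, dk−1) ≤ X/unitF(3, d(k−1))`
  (`jumpW_mul_div_klLevUnitF_le` at `p = 3`: the jump is FREE in floor units at six legs), then the INDUCTION HYPOTHESIS of the kit — the law `A·λ²·Q′³` on the born
  array of block `k−1` (G1's `hR3` hook = the kit's `hprof3`) — ONE block back, so no sum over the history and no logarithm;
so `W·Z³·μ₃(k) ≤ W·Z³·(C₁jC₂j⁵·A·Q′³ + C₆·CE³/ε_x⁵)·λ² ≤ ι₃·λ²` under the domination `W·Z³·(C₁j·C₂j⁵·(A·Q′³) + C₆·Qe.CE³/ε_x⁵) ≤ ι₃`; block 1: the base law at `p = 3`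
under `W·Z³·(Ab·Qb³) ≤ ι₃`.
* **`klTowerBornWtAt_le_law_of_blocks_klEng_tokX_six (R c″)`** — `∃ C₁ C₂ Cκ CJ C₁j C₂j C₆ > 0, ∀ d, ∃ Cb > 0, (R.WF2 → ∃ c₃′ U₀′ > 0, …)`; binders = file A's with
  the six-leg import row REPLACED by: `epsCoupling P U j ≤ lam`, `∀ Qe, 0 ≤ Qe.CE`, the sectorised six-leg cells at `d ≤ j′ ≤ n`, the two `ι₃` dominations;
  conclusions = file A's three + the six-leg measured rows `W·Z³·μ₃(k) ≤ ι₃·λ²` at every block `1 ≤ k ≤ K_b` (the read-out at block `K_b` reads them).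
Compositions of landed theorems and real algebra; nothing about the model is asserted beyond them; nothing asserts (b), (ℓ), any stub, K3 or superconductivity.
References: BGM 2006 §2.3 (2.13)–(2.14), §2.7 (2.71a), (2.77), §2.8 (2.76)–(2.84), (2.88)–(2.90), (2.93)–(2.98), §3 (3.2)–(3.8) [cite: BenfattoGiulianiMastropietro2006].
-/

noncomputable section

namespace Summit.HubbardSuperconductivity.HubbardSuperconductivity.Theorems.EngineV8

set_option linter.dupNamespace false -- summit = problem name (single-conjunct summit), D-0017

open Classical
open Real Finset Literature.MathematicalPhysics.QuantumLattice Literature.Probability.LatticeModels GrassmannAlgebra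
open Literature.MathematicalPhysics.QuantumLattice.FermiRG Literature.MathematicalPhysics.QuantumLattice.FermiRG.BGM2006Routing
open Summit.HubbardSuperconductivity.HubbardSuperconductivity.Theorems.KLProgrammeLegKernels
open Summit.HubbardSuperconductivity.HubbardSuperconductivity.Theorems.KLRegimeSplit
open Summit.HubbardSuperconductivity.HubbardSuperconductivity.Theorems.KLRegimeWick
open Summit.HubbardSuperconductivity.HubbardSuperconductivity.Theorems.TwoPointAssembly
open Summit.HubbardSuperconductivity.HubbardSuperconductivity.Theorems.DispersionFlow
open Summit.HubbardSuperconductivity.HubbardSuperconductivity.Theorems.TorusFourierL2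

variable {L M : ℕ} [NeZero L] [NeZero M]

/-! ## The one-track weighted law on `K_n`, six-leg side discharged -/

set_option maxHeartbeats 400000 in -- one ~130-binder composition of six landed theorems
/-- **THE ONE-TRACK WEIGHTED TOWER LAW ON `K_n` — LINK, Z-THREAD, BRIDGE, BLOCK-1 PROFILE AND THE SIX-LEG SIDE DISCHARGED; BASE DATUM, TWO- AND FOUR-LEG IMPORTS,
SECTORISED SIX-LEG CELLS AND NUMERICS AS ROWS** (♯5 «6LEG-INSIDE»; «D-ORDER» cured: the d-free constants `C₁ C₂ Cκ CJ C₁j C₂j C₆` precede `∀ d`; see the module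
docstring for the six-leg mechanism and the binder list). [cite: BenfattoGiulianiMastropietro2006, §2.3 (2.13)-(2.14), §2.8 (2.76)-(2.84), (2.88)-(2.90), (2.93)-(2.98), §3 (3.2)-(3.8)] -/
theorem klTowerBornWtAt_le_law_of_blocks_klEng_tokX_six (R : RenConsts) (c'' : ℝ) (hc'' : 0 < c'') :
    ∃ C₁ C₂ Cκ CJ C₁j C₂j C₆ : ℝ, 0 < C₁ ∧ 0 < C₂ ∧ 0 < Cκ ∧ 0 < CJ ∧ 0 < C₁j ∧ 0 < C₂j ∧ 0 < C₆ ∧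
      ∀ d : ℕ, ∃ Cb : ℝ, 0 < Cb ∧ (R.WF2 → ∃ c₃' : ℝ, 0 < c₃' ∧ ∃ U₀' : ℝ, 0 < U₀' ∧
      ∀ (G : GeoConsts) (P : SplitConsts) (Q : EngConsts) (c : ℝ), P.WF → 0 < c → c ≤ klEngC₃6 P R → c ≤ c₃' →
      ∀ μ ∈ klWindowC, ∀ U : ℝ, 0 < U → U ≤ klEngU₀9 P R c → U ≤ U₀' → c'' * U ≤ 1 →
      ∀ β : ℝ, klBetaMin ≤ β → β ≤ Real.exp (c / U ^ 2) →
      ∀ (L M : ℕ) [NeZero L] [NeZero M], klEngL₃ β U ≤ L → klEngM₃ β U L ≤ M →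
      ∀ n : ℕ, 1 ≤ n → n ≤ nScales β + 1 → IsKLRegime U c (-(n : ℤ)) → HistP klPredsV17F2 L M G P Q R β U μ 0 n →
        (∀ m', 1 ≤ m' → m' < n → FlowPieceOscAt L M c'' β U μ m') →
      2 ≤ d → ∀ Kb j : ℕ, 1 ≤ Kb → d * Kb ≤ j → j ≤ n →
      ∀ D : ℕ, 3 ≤ D → (∀ k, 1 ≤ k → k ≤ Kb → Fintype.card (SpaceTimeIdx L M × SectorLeg (sectorCount (d * k - 1))) / 2 ≤ D) →
      ∀ (A lam Q' Ab Qb : ℝ), 0 ≤ A → 0 < lam → 0 < Q' → 0 ≤ Ab → 0 ≤ Qb →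
      -- the base datum of `𝒱_d` at `(F_{d−1}, rate j)` and its unit law [p3 class]
      ∀ Nb : ℕ → ℝ, (∀ p, 0 ≤ Nb p) →
        (∀ (p : ℕ) (q : Fin (2 * p)) (w' : SpaceTimeIdx L M × SectorLeg (sectorCount (d - 1))),
          klWtPinnedSumAt L M β μ (klFlowFrameU L M β U μ n) (d - 1) j (2 * p) (klTowerInput L M β U μ (klFlowFrameU L M β U μ n) d 1) q w' ≤ Nb p) →
        (∀ p : ℕ, 3 ≤ p → Nb p / klLevUnitF β M 0 p (d - 1) ≤ Ab * lam ^ (p - 1) * Qb ^ p) →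
      hubbardEffPartitionFnCT L M β U μ 0 (klFlowFrameU L M β U μ n) (klScale klE0 d) ≠ 0 →
      -- the names
      -- the k-free bounds: ANY dominants of the LINK's constants (so that a read-out step may share them)
      ∀ (κb αb crb ccb : ℝ), Real.sqrt (2 * Cκ * klE0) ≤ κb → Cb * ((M : ℝ) / β) * (4 : ℝ) ^ d / klE0 ≤ αb →
        81 * CJ * M / β ≤ crb → 162 * CJ * M / β ≤ ccb →
      ∀ (W Z σ τ ψ Φ : ℝ),
        W = 32 * crb / ccb → Z = imagTimeWeight β M ^ 2 * ccb ^ 2 / 8 →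
        σ = κb ^ 2 / ccb ^ 2 → τ = 4 * exp 4 * κb ^ 2 / ccb ^ 2 → ψ = ccb ^ 2 / κb ^ 2 → Φ = exp 1 * αb * ccb / (κb ^ 2 * crb) →
      ∀ (A' Q'' : ℝ),
        W * ((C₁ / C₂) * (8 : ℝ) ^ (d - 1) * (Ab + A / (1 - ((2 : ℝ) ^ d)⁻¹))) ≤ A' →
        Z * (C₂ ^ 2 * ((2 : ℝ) ^ (d - 1))⁻¹ * max Q' Qb) ≤ Q'' → W * Ab ≤ A' → Z * Qb ≤ Q'' → 0 < Q'' →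
      -- the weighted two- and four-leg imports at every block 1 ≤ k ≤ Kb [E1 class]
      ∀ (ι₁ ι₂ ι₃ : ℝ),
      (∀ k, 1 ≤ k → k ≤ Kb → W * Z ^ 1 *
        (klTowerMeasWtAt L M β U μ (klFlowFrameU L M β U μ n) d k j (2 * 1) / klLevUnitF β M 0 1 (d * k - 1)) ≤ ι₁ * lam) →
      (∀ k, 1 ≤ k → k ≤ Kb → W * Z ^ 2 *
        (klTowerMeasWtAt L M β U μ (klFlowFrameU L M β U μ n) d k j (2 * 2) / klLevUnitF β M 0 2 (d * k - 1)) ≤ ι₂ * lam) →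
      -- the six-leg side (♯5 «6LEG-INSIDE»): the coupling floor `ε_j ≤ λ`, the SECTORISED six-leg cells of `𝒱_{j′}[K_n]` at the levels `d ≤ j′ ≤ n`
      -- [E1: BGM 2006 (2.77), `|P_{v₀}| = 6`] and the six-leg amplitude `ι₃` under two dominations [numerics] — NO six-leg import row
      epsCoupling P U j ≤ lam → ∀ Qe : EngConsts, 0 ≤ Qe.CE →
      (∀ j', d ≤ j' → j' ≤ n → ∀ (q : Fin 6) (w : SpaceTimeIdx L M × SectorLeg (sectorCount j')),
        klWtPinnedSum L M β U μ (klFlowFrameU L M β U μ n) j' 6 q w ≤ klWtBudget P Qe U j' 6) →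
      W * Z ^ 3 * (Ab * Qb ^ 3) ≤ ι₃ → W * Z ^ 3 * (C₁j * C₂j ^ 5 * (A * Q' ^ 3) + C₆ * Qe.CE ^ 3 / imagTimeWeight β M ^ 5) ≤ ι₃ →
      -- the kit's numerics [p4 class]
      4 * σ * lam * Q'' < 1 → 2 * lam * τ * Q'' ≤ 1 → exp 1 * τ * lam * Q'' < 1 →
      Φ * (τ * (ι₁ * lam + ι₂ / (2 * Q'') + ι₃ / (4 * Q'' ^ 2) + A' * Q'' / 4)) < 1 →
      Φ * (exp 1 * τ * (ι₁ * lam) + (exp 1 * τ) ^ 2 * (ι₂ * lam) + (exp 1 * τ) ^ 3 * (ι₃ * lam ^ 2) +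
        A' * (exp 1 * τ * Q'') * ((exp 1 * τ * lam * Q'') ^ 3 / (1 - exp 1 * τ * lam * Q''))) < 1 →
      4 * Q'' ≤ Q' → 2 * τ * ψ * Q'' ≤ Q' →
      A' * (4 * Q'') ^ 3 * (4 * σ * lam * Q'' / (1 - 4 * σ * lam * Q'')) +
        exp 1 * ψ * (2 * τ * ψ * Q'') ^ 2 * (τ * (ι₁ * lam + ι₂ / (2 * Q'') + ι₃ / (4 * Q'' ^ 2) + A' * Q'' / 4)) *
          (Φ * (τ * (ι₁ * lam + ι₂ / (2 * Q'') + ι₃ / (4 * Q'' ^ 2) + A' * Q'' / 4)) /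
            (1 - Φ * (τ * (ι₁ * lam + ι₂ / (2 * Q'') + ι₃ / (4 * Q'' ^ 2) + A' * Q'' / 4)))) ≤ A * Q' ^ 3 →
      (∀ k, 1 ≤ k → k ≤ Kb → hubbardEffPartitionFnCT L M β U μ 0 (klFlowFrameU L M β U μ n) (klScale klE0 (d * k)) ≠ 0) ∧
      (∀ k, 2 ≤ k → k ≤ Kb → ∀ p : ℕ, 3 ≤ p → p ≤ D →
        klTowerBornWtAt L M β U μ (klFlowFrameU L M β U μ n) d (k - 1) j (2 * p) / klLevUnitF β M 0 p (d * (k - 1)) ≤ A * lam ^ (p - 1) * Q' ^ p) ∧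
      (∀ k, 1 ≤ k → k ≤ Kb → ∀ m, 4 ≤ m → m ≤ D → W * Z ^ m *
        (klTowerMeasWtAt L M β U μ (klFlowFrameU L M β U μ n) d k j (2 * m) / klLevUnitF β M 0 m (d * k - 1)) ≤ A' * lam ^ (m - 1) * Q'' ^ m) ∧
      (∀ k, 1 ≤ k → k ≤ Kb → W * Z ^ 3 *
        (klTowerMeasWtAt L M β U μ (klFlowFrameU L M β U μ n) d k j (2 * 3) / klLevUnitF β M 0 3 (d * k - 1)) ≤ ι₃ * lam ^ 2)) := by
  obtain ⟨C₁, C₂, hC₁, hC₂, hprofR⟩ := klTowerMeasWtAt_div_le_profileR_base_klEng R c'' hc''.le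
  obtain ⟨Cκ, CJ, hCκ, hCJ, hlinkU⟩ := linkDataW_klEng_unif R c'' hc''
  obtain ⟨C₁j, C₂j, hC₁j, hC₂j, hjmpU⟩ := klWtPinnedSumAt_klTowerIncr_remeasure_le_klEng_flow_all_uniform R c'' hc''.le
  obtain ⟨C₆, hC₆, hrdrU⟩ := klWtPinnedSumOf_six_klTowerInput_jump_le_budget_klEng_flow_all R c'' hc''.le
  refine ⟨C₁, C₂, Cκ, CJ, C₁j, C₂j, C₆, hC₁, hC₂, hCκ, hCJ, hC₁j, hC₂j, hC₆, fun d => ?_⟩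
  obtain ⟨Cb, hCb, hlink⟩ := hlinkU d
  refine ⟨Cb, hCb, fun hR2 => ?_⟩
  obtain ⟨c₃, hc₃, U₀, hU₀, hprof'⟩ := hprofR hR2
  obtain ⟨c₃j, hc₃j, U₀j, hU₀j, hjmp⟩ := hjmpU hR2
  obtain ⟨c₃r, hc₃r, U₀r, hU₀r, hrdr⟩ := hrdrU hR2
  refine ⟨min c₃ (min c₃j c₃r), lt_min hc₃ (lt_min hc₃j hc₃r), min U₀ (min U₀j U₀r), lt_min hU₀ (lt_min hU₀j hU₀r), ?_⟩
  intro G P Q c hP hc hc6 hc₃' μ hμ U hU hU9 hU₀' hcU β hβmin hβc L M _ _ hL3 hM3 n hn1 hnN hkl hhist hosc hd Kb j hKb1 hKbj hjn D hD3 hD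
    A lam Q' Ab Qb hA hlam hQ hAb hQb Nb hNb0 hcar hlawb hZd κb αb crb ccb hκb hαb hcrb hccb W Z σ τ ψ Φ hW hZ' hσ hτ hψ hΦ
    A' Q'' hA'1 hQ'1 hA'2 hQ'2 hQ'0 ι₁ ι₂ ι₃ hι₁ hι₂ hεlam Qe hCE hC6 hdom₁ hdom₂ hx₁ hx₂ hx₃ hy hθ hu₁ hu₂ hclose
  have he : (0 : ℝ) < klE0 := by norm_num [klE0]
  have hβ : 0 < β := KLRegimeSplit.pos_of_klBetaMin_le hβmin
  have hM0 : (0 : ℝ) < M := Nat.cast_pos.2 (Nat.pos_of_ne_zero (NeZero.ne M))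
  have hx : 0 < imagTimeWeight β M := imagTimeWeight_pos_of_pos (M := M) hβ
  have hfr : FrameOK R U (nScales β) μ (klFlowFrameU L M β U μ n) := frameOK_klFlowFrameU_of_histP_le hR2 hn1 le_rfl hnN hhist
  set K : TrigPolyC4v := klFlowFrameU L M β U μ n with hKdef
  -- the four k-free constants are positive; so are the six names
  have hsq0 : 0 < Real.sqrt (2 * Cκ * klE0) := Real.sqrt_pos.2 (by positivity)
  have hκb0 : 0 < κb := lt_of_lt_of_le hsq0 hκb
  have hαb0 : 0 < αb := lt_of_lt_of_le (by positivity) hαb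
  have hcrb0 : 0 < crb := lt_of_lt_of_le (by positivity) hcrb
  have hccb0 : 0 < ccb := lt_of_lt_of_le (by positivity) hccb
  have hκbsq : Real.sqrt (2 * Cκ * klE0) ^ 2 ≤ κb ^ 2 := pow_le_pow_left₀ hsq0.le hκb 2
  have hW0 : 0 < W := by rw [hW]; positivity
  have hZ0 : 0 < Z := by rw [hZ']; positivity
  have hσ0 : 0 ≤ σ := by rw [hσ]; positivity
  have hτ0 : 0 < τ := by rw [hτ]; positivity
  have hψ0 : 0 ≤ ψ := by rw [hψ]; positivity
  have hΦ0 : 0 ≤ Φ := by rw [hΦ]; positivity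
  -- block ranges
  have hblk : ∀ k, 1 ≤ k → k < Kb → 2 ≤ d * k ∧ d * (k + 1) ≤ nScales β + 1 ∧ d * k ≤ n ∧ d * k ≤ j := by
    intro k hk1 hk
    have h1 : d * (k + 1) ≤ d * Kb := Nat.mul_le_mul_left d (by omega)
    have h2 : d * k + d = d * (k + 1) := (Nat.mul_succ d k).symm
    refine ⟨le_trans hd (Nat.le_mul_of_pos_right d hk1), by omega, by omega, by omega⟩
  -- the per-block data, ONE bundle for the step and the Z-thread
  set κf : ℕ → ℝ := fun k => Real.sqrt (Cκ * (klScale klE0 (d * k) / klScale klE0 (d * k - 1)) * (klE0 * ((8 : ℝ) ^ (d * k - 1))⁻¹)) with hκf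
  set αf : ℕ → ℝ := fun k => Cb * ((M : ℝ) / β) / klScale klE0 (d * (k + 1)) with hαf
  have hdata : ∀ k, 1 ≤ k → k < Kb →
      0 < κf k ∧ κf k ^ 2 * (8 : ℝ) ^ (d * k) ≤ κb ^ 2 ∧
      IsGramBoundedR ((sectorSubMatrix L M β (bgmFatMultiplier L M klE0 β (nambuXiCT L μ K) (d * k - 1))).transpose *
        hubbardCovSliceCT L M β μ 0 K (klScale klE0 (d * (k + 1))) (klScale klE0 (d * k)) *
          sectorSubMatrix L M β (bgmFatMultiplier L M klE0 β (nambuXiCT L μ K) (d * k - 1))) (κf k) ∧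
      (∀ X, ∑ Y, ‖((sectorSubMatrix L M β (bgmFatMultiplier L M klE0 β (nambuXiCT L μ K) (d * k - 1))).transpose *
        hubbardCovSliceCT L M β μ 0 K (klScale klE0 (d * (k + 1))) (klScale klE0 (d * k)) *
          sectorSubMatrix L M β (bgmFatMultiplier L M klE0 β (nambuXiCT L μ K) (d * k - 1))) X Y‖ *
        klScaleWt L M β j {latticeLegPos (2 * (2 * M)) X, latticeLegPos (2 * (2 * M)) Y} ≤ αf k) ∧
      (∀ Y, ∑ X, ‖((sectorSubMatrix L M β (bgmFatMultiplier L M klE0 β (nambuXiCT L μ K) (d * k - 1))).transpose *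
        hubbardCovSliceCT L M β μ 0 K (klScale klE0 (d * (k + 1))) (klScale klE0 (d * k)) *
          sectorSubMatrix L M β (bgmFatMultiplier L M klE0 β (nambuXiCT L μ K) (d * k - 1))) X Y‖ *
        klScaleWt L M β j {latticeLegPos (2 * (2 * M)) X, latticeLegPos (2 * (2 * M)) Y} ≤ αf k) ∧
      αf k ≤ αb * (4 : ℝ) ^ (d * k) ∧
      (∀ X'', ∑ X', ‖(sectorAnalysisMatrix L M β (klAnisoFamily L M β μ K klE0 (d * k)) *
        sectorSubMatrix L M β (bgmFatMultiplier L M klE0 β (nambuXiCT L μ K) (d * k - 1))) X'' X'‖ *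
        klScaleWt L M β j {latticeLegPos (2 * (2 * M)) X'', latticeLegPos (2 * (2 * M)) X'} ≤ crb) ∧
      (∀ X', ∑ X'', ‖(sectorAnalysisMatrix L M β (klAnisoFamily L M β μ K klE0 (d * k)) *
        sectorSubMatrix L M β (bgmFatMultiplier L M klE0 β (nambuXiCT L μ K) (d * k - 1))) X'' X'‖ *
        klScaleWt L M β j {latticeLegPos (2 * (2 * M)) X'', latticeLegPos (2 * (2 * M)) X'} ≤ ccb) := by
    intro k hk1 hk
    obtain ⟨hdk, hkN, hkn, hkj⟩ := hblk k hk1 hk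
    obtain ⟨h1, h2, h3, h4, h5, h6, h7, h8⟩ := hlink G P Q c hP hR2 hc hc6 μ hμ U hU hU9 hcU β hβmin hβc L M hL3 hM3 n hn1 hnN hkl hhist hfr hosc
      k hk1 hdk hkN hkn j hkj
    refine ⟨h1, h2.trans hκbsq, h3, h4, h5, h6.trans (mul_le_mul_of_nonneg_right hαb (by positivity)), fun X'' => (h7 X'').trans hcrb,
      fun X' => (h8 X').trans hccb⟩
  -- the step (W2) and the Z-thread (W4) from the bundle
  have hstep := wtLaw_hstep_of_blockBounds (L := L) (M := M) hβ U μ K (by omega : 1 ≤ d) j Kb hκb0 hαb0 hcrb0 hccb0 κf αf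
    (fun k hk1 hk => (hdata k hk1 hk).1) (fun k hk1 hk => (hdata k hk1 hk).2.1) (fun k hk1 hk => (hdata k hk1 hk).2.2.2.2.2.1)
    (fun k hk1 hk => (hdata k hk1 hk).2.2.1) (fun k hk1 hk => (hdata k hk1 hk).2.2.2.1) (fun k hk1 hk => (hdata k hk1 hk).2.2.2.2.1)
    (fun k hk1 hk => (hdata k hk1 hk).2.2.2.2.2.2.1) (fun k hk1 hk => (hdata k hk1 hk).2.2.2.2.2.2.2) (fun k hk1 hk => hD k hk1 hk.le)
    W Z σ τ ψ Φ hW hZ' hσ hτ hψ hΦ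
  have hZsucc := wtLaw_hZsucc_of_blockBounds (L := L) (M := M) hβ U μ K (by omega : 1 ≤ d) j Kb hκb0 hαb0 hcrb0 hccb0 κf αf
    (fun k hk1 hk => (hdata k hk1 hk).1) (fun k hk1 hk => (hdata k hk1 hk).2.1) (fun k hk1 hk => (hdata k hk1 hk).2.2.2.2.2.1)
    (fun k hk1 hk => (hdata k hk1 hk).2.2.1) (fun k hk1 hk => (hdata k hk1 hk).2.2.2.1) (fun k hk1 hk => (hdata k hk1 hk).2.2.2.2.1)
    (fun k hk1 hk => hD k hk1 hk.le) W Z τ Φ hW hZ' hτ hΦ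
  -- the block-1 profile from the base rows
  have hZ1 : hubbardEffPartitionFnCT L M β U μ 0 K (klScale klE0 (d * 1)) ≠ 0 := by rw [Nat.mul_one]; exact hZd
  have hbase : ∀ m, 4 ≤ m → m ≤ D →
      W * Z ^ m * (klTowerMeasWtAt L M β U μ K d 1 j (2 * m) / klLevUnitF β M 0 m (d * 1 - 1)) ≤ A' * lam ^ (m - 1) * Q'' ^ m := by
    intro m hm hmD
    have hu0 : 0 < klLevUnitF β M 0 m (d - 1) := klLevUnitF_pos hβ 0 m _
    have hmeas : klTowerMeasWtAt L M β U μ K d 1 j (2 * m) ≤ Nb m :=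
      klTowerMeasWtAt_le_of_rows β U μ K d 1 j (2 * m) (by omega : d * 1 - 1 = d - 1) (hNb0 m) (hcar m)
    have h1 : klTowerMeasWtAt L M β U μ K d 1 j (2 * m) / klLevUnitF β M 0 m (d * 1 - 1) ≤ Ab * lam ^ (m - 1) * Qb ^ m := by
      rw [show d * 1 - 1 = d - 1 by omega]
      exact (div_le_div_of_nonneg_right hmeas hu0.le).trans (hlawb m (by omega))
    have hWZ : 0 ≤ W * Z ^ m := by positivity
    calc W * Z ^ m * (klTowerMeasWtAt L M β U μ K d 1 j (2 * m) / klLevUnitF β M 0 m (d * 1 - 1))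
        ≤ W * Z ^ m * (Ab * lam ^ (m - 1) * Qb ^ m) := mul_le_mul_of_nonneg_left h1 hWZ
      _ = (W * Ab) * lam ^ (m - 1) * (Z * Qb) ^ m := by rw [mul_pow]; ring
      _ ≤ A' * lam ^ (m - 1) * Q'' ^ m := by
          have hA'0 : 0 ≤ A' := le_trans (by positivity) hA'2
          exact mul_le_mul (mul_le_mul_of_nonneg_right hA'2 (pow_nonneg hlam.le _)) (pow_le_pow_left₀ (by positivity) hQ'2 m)
            (pow_nonneg (by positivity) _) (by positivity)
  -- the folded doors and the doors of the three packages
  have hc₃a : c ≤ c₃ := hc₃'.trans (min_le_left _ _)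
  have hc₃b : c ≤ c₃j := hc₃'.trans ((min_le_right _ _).trans (min_le_left _ _))
  have hc₃c : c ≤ c₃r := hc₃'.trans ((min_le_right _ _).trans (min_le_right _ _))
  have hU₀a : U ≤ U₀ := hU₀'.trans (min_le_left _ _)
  have hU₀b : U ≤ U₀j := hU₀'.trans ((min_le_right _ _).trans (min_le_left _ _))
  have hU₀c : U ≤ U₀r := hU₀'.trans ((min_le_right _ _).trans (min_le_right _ _))
  have hU3g : U ≤ min (klEngU₀3 P R c) (1 / (R.Gfr 3 + 1)) :=
    le_min (hU9.trans (klEngU₀9_le_klEngU₀3 P R c)) (hU9.trans (klEngU₀9_le_inv_gfr_add_one P hR2.wf c (by norm_num)))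
  have hK1 : 1 ≤ P.Klam := hP.1
  have hKl : 0 ≤ P.Klam := le_trans zero_le_one hK1
  have hε0 : ∀ i, 0 ≤ epsCoupling P U i := fun i => epsCoupling_nonneg' hKl U i
  have hεmono : ∀ {a b : ℕ}, a ≤ b → epsCoupling P U a ≤ epsCoupling P U b := fun {a b} hab => by
    unfold epsCoupling
    exact mul_le_mul_of_nonneg_left ((add_le_add_iff_left |U|).2 (mul_le_mul_of_nonneg_left (Nat.cast_le.2 hab) (sq_nonneg U))) hKl
  -- the bridge `hR` at the blocks `k ≥ 2` (degrees `2m ≥ 8`), from the weighted `R` rows (W3b verbatim)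
  set AR : ℝ := (C₁ / C₂) * (8 : ℝ) ^ (d - 1) * (Ab + A / (1 - ((2 : ℝ) ^ d)⁻¹)) with hAR
  set QR : ℝ := C₂ ^ 2 * ((2 : ℝ) ^ (d - 1))⁻¹ * max Q' Qb with hQR
  have hρ1 : ((2 : ℝ) ^ d)⁻¹ < 1 := inv_lt_one_of_one_lt₀ (one_lt_pow₀ (by norm_num) (by omega))
  have hAR0 : 0 ≤ AR := by
    have : 0 ≤ A / (1 - ((2 : ℝ) ^ d)⁻¹) := div_nonneg hA (sub_nonneg.2 hρ1.le)
    positivity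
  have hQR0 : 0 ≤ QR := by
    have : 0 ≤ max Q' Qb := le_max_of_le_left hQ.le
    positivity
  have hA'0 : 0 ≤ A' := le_trans (by positivity) hA'1
  have hdom : ∀ m : ℕ, W * Z ^ m * (AR * lam ^ (m - 1) * QR ^ m) ≤ A' * lam ^ (m - 1) * Q'' ^ m := fun m => by
    rw [show W * Z ^ m * (AR * lam ^ (m - 1) * QR ^ m) = W * AR * lam ^ (m - 1) * (Z * QR) ^ m by rw [mul_pow]; ring]
    exact mul_le_mul (mul_le_mul_of_nonneg_right hA'1 (pow_nonneg hlam.le _)) (pow_le_pow_left₀ (by positivity) hQ'1 m)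
      (pow_nonneg (by positivity) _) (by positivity)
  have hR : ∀ k, 2 ≤ k → k ≤ Kb →
      (∀ k', 2 ≤ k' → k' ≤ k → ∀ p, 3 ≤ p → p ≤ D →
        klTowerBornWtAt L M β U μ K d (k' - 1) j (2 * p) / klLevUnitF β M 0 p (d * (k' - 1)) ≤ A * lam ^ (p - 1) * Q' ^ p) →
      ∀ m, 4 ≤ m → m ≤ D →
        W * Z ^ m * (klTowerMeasWtAt L M β U μ K d k j (2 * m) / klLevUnitF β M 0 m (d * k - 1)) ≤ A' * lam ^ (m - 1) * Q'' ^ m := by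
    intro k hk2 hkK ih m hm hmD
    have hd2k : d * 2 ≤ d * k := Nat.mul_le_mul_left d hk2
    have hkKd : d * k ≤ d * Kb := Nat.mul_le_mul_left d hkK
    have hrow := hprof' G P Q c hc hc6 hc₃a μ hμ U hU hU3g hU₀a hcU β hβmin hβc L M hL3 hM3 n hn1 hnN hkl hhist hosc d k hd hk2 (by omega) j (by omega) D
      A lam Q' Ab Qb hA hlam.le hQ.le hAb hQb Nb hNb0 hcar hlawb ih m hm hmD
    exact (mul_le_mul_of_nonneg_left hrow (by positivity)).trans (hdom m)
  -- ♯5: block 1's six-leg datum from the base law at `p = 3` and the first domination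
  have hι₃base : W * Z ^ 3 * (klTowerMeasWtAt L M β U μ K d 1 j (2 * 3) / klLevUnitF β M 0 3 (d * 1 - 1)) ≤ ι₃ * lam ^ 2 := by
    have hu0 : 0 < klLevUnitF β M 0 3 (d - 1) := klLevUnitF_pos hβ 0 3 _
    have hmeas : klTowerMeasWtAt L M β U μ K d 1 j (2 * 3) ≤ Nb 3 :=
      klTowerMeasWtAt_le_of_rows β U μ K d 1 j (2 * 3) (by omega : d * 1 - 1 = d - 1) (hNb0 3) (hcar 3)
    have h1 : klTowerMeasWtAt L M β U μ K d 1 j (2 * 3) / klLevUnitF β M 0 3 (d * 1 - 1) ≤ Ab * lam ^ 2 * Qb ^ 3 := by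
      rw [show d * 1 - 1 = d - 1 by omega]
      exact (div_le_div_of_nonneg_right hmeas hu0.le).trans (hlawb 3 le_rfl)
    calc W * Z ^ 3 * (klTowerMeasWtAt L M β U μ K d 1 j (2 * 3) / klLevUnitF β M 0 3 (d * 1 - 1))
        ≤ W * Z ^ 3 * (Ab * lam ^ 2 * Qb ^ 3) := mul_le_mul_of_nonneg_left h1 (by positivity)
      _ = W * Z ^ 3 * (Ab * Qb ^ 3) * lam ^ 2 := by ring
      _ ≤ ι₃ * lam ^ 2 := mul_le_mul_of_nonneg_right hdom₁ (pow_nonneg hlam.le 2)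
  -- ♯5: the six-leg BRIDGE at the blocks `k ≥ 2` — `𝒱_{dk} = 𝒱_{d(k−1)} + Δ_{k−1}`: the previous input from its SECTORISED cell at level `d(k−1)` refined to
  -- `dk − 1` (k3c2-p3's reader, budget-neutral), the increment from the law at `p = 3` one block back and ONE weighted jump of `d − 1` levels (no cost in floor units)
  have hunit6 : ∀ J : ℕ, klWtBudget P Qe U J 6 / klLevUnitF β M 0 3 J = Qe.CE ^ 3 * epsCoupling P U J ^ 2 / imagTimeWeight β M ^ 5 := by
    intro J
    have h2 : (0 : ℝ) < (2 : ℝ) ^ (4 * J) := by positivity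
    have h5 : (0 : ℝ) < (2 : ℝ) ^ (5 * J) := by positivity
    have h8 : (8 : ℝ) ^ (J * 3) = (2 : ℝ) ^ (4 * J) * (2 : ℝ) ^ (5 * J) := by
      rw [show (8 : ℝ) = 2 ^ 3 by norm_num, ← pow_mul, ← pow_add]; congr 1; ring
    have hu : klLevUnitF β M 0 3 J = imagTimeWeight β M ^ 5 * (2 : ℝ) ^ (4 * J) := by
      unfold klLevUnitF
      rw [show klLevGain 0 = 0 from rfl, zero_mul, pow_zero, mul_one, show (2 * 3 - 1 : ℕ) = 5 from rfl, h8, mul_div_assoc, mul_div_assoc,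
        div_self (ne_of_gt h5), mul_one]
    rw [klWtBudget_six_eq, hu, mul_div_mul_right _ _ (ne_of_gt h2)]
  have hR3 : ∀ k, 2 ≤ k → k ≤ Kb →
      (∀ k', 2 ≤ k' → k' ≤ k → ∀ p, 3 ≤ p → p ≤ D →
        klTowerBornWtAt L M β U μ K d (k' - 1) j (2 * p) / klLevUnitF β M 0 p (d * (k' - 1)) ≤ A * lam ^ (p - 1) * Q' ^ p) →
      W * Z ^ 3 * (klTowerMeasWtAt L M β U μ K d k j (2 * 3) / klLevUnitF β M 0 3 (d * k - 1)) ≤ ι₃ * lam ^ 2 := by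
    intro k hk2 hkK ih
    have hkKd : d * k ≤ d * Kb := Nat.mul_le_mul_left d hkK
    have hdk2 : d * 2 ≤ d * k := Nat.mul_le_mul_left d hk2
    have hsub : d * (k - 1) = d * k - d := Nat.mul_sub_one d k
    have hdk1n : d * k - 1 ≤ n := by omega
    have hdk1j : d * k - 1 ≤ j := by omega
    have hlev : d ≤ d * (k - 1) := by rw [hsub]; omega
    have hlevn : d * (k - 1) ≤ n := by rw [hsub]; omega
    have hJ : d * (k - 1) + 1 ≤ d * k - 1 := by rw [hsub]; omega
    have hJle : d * (k - 1) ≤ d * k - 1 := by omega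
    have hu1 : 0 < klLevUnitF β M 0 3 (d * k - 1) := klLevUnitF_pos hβ 0 3 _
    have hu0 : 0 < klLevUnitF β M 0 3 (d * (k - 1)) := klLevUnitF_pos hβ 0 3 _
    -- (cell) the previous input `𝒱_{d(k−1)}` at `F_{dk−1}`, tied rate, from its sectorised cell at level `d(k−1)`
    have hcellk : ∀ (q : Fin 6) (w' : SpaceTimeIdx L M × SectorLeg (sectorCount (d * (k - 1)))),
        klWtPinnedSumOf L M β μ K (d * (k - 1)) 6 (klTowerInput L M β U μ K d (k - 1)) q w' ≤ klWtBudget P Qe U (d * (k - 1)) 6 := by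
      intro q w'
      rw [show klTowerInput L M β U μ K d (k - 1) = klEffectiveAction L M β U μ K klE0 (d * (k - 1)) from rfl, klWtPinnedSumOf_klEffectiveAction]
      exact hC6 (d * (k - 1)) hlev hlevn q w'
    have hV : ∀ (q : Fin 6) (w : SpaceTimeIdx L M × SectorLeg (sectorCount (d * k - 1))),
        klWtPinnedSumOf L M β μ K (d * k - 1) 6 (klTowerInput L M β U μ K d (k - 1)) q w ≤ C₆ * klWtBudget P Qe U (d * k - 1) 6 :=
      fun q w => hrdr G P Q c hP hc hc6 hc₃c μ hμ U hU hU3g hU₀c hcU β hβmin hβc L M hL3 hM3 n hn1 hnN hkl hhist hosc Qe hCE d (k - 1) (d * (k - 1))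
        (d * k - 1) hJ hdk1n hcellk q w
    -- (Δ) the increment `Δ_{k−1}` re-measured at `F_{dk−1}`, rate `j`, from its born array
    have hΔ : ∀ (q : Fin (5 + 1)) (w : SpaceTimeIdx L M × SectorLeg (sectorCount (d * k - 1))),
        klWtPinnedSumAt L M β μ K (d * k - 1) j (5 + 1) (klTowerIncr L M β U μ K d (k - 1)) q w ≤
          C₁j * C₂j ^ 5 * ((2 : ℝ) ^ (d * k - 1 - d * (k - 1))) ^ (5 - 1) * klTowerBornWtAt L M β U μ K d (k - 1) j (5 + 1) :=
      fun q w => hjmp 5 G P Q c hc hc6 hc₃b μ hμ U hU hU3g hU₀b hcU β hβmin hβc L M hL3 hM3 n hn1 hnN hkl hhist hosc d k (k - 1) hd (by omega) hdk1n j hdk1j q w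
    -- one common bound of the rate-`j` pinned sums of `𝒱_{dk}` at `F_{dk−1}`
    set Nk : ℝ := C₆ * klWtBudget P Qe U (d * k - 1) 6 +
      C₁j * C₂j ^ 5 * ((2 : ℝ) ^ (d * k - 1 - d * (k - 1))) ^ (2 * 3 - 2) * klTowerBornWtAt L M β U μ K d (k - 1) j (2 * 3) with hNk
    have hborn0 : 0 ≤ klTowerBornWtAt L M β U μ K d (k - 1) j (2 * 3) := klTowerBornWtAt_nonneg hβ.le U μ K d (k - 1) j _
    have hbud0 : 0 ≤ klWtBudget P Qe U (d * k - 1) 6 := klWtBudget_nonneg hCE hKl U _ 6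
    have hNk0 : 0 ≤ Nk := by positivity
    have hsum : ∀ (q : Fin (2 * 3)) (w : SpaceTimeIdx L M × SectorLeg (sectorCount (d * k - 1))),
        klWtPinnedSumAt L M β μ K (d * k - 1) j (2 * 3) (klTowerInput L M β U μ K d k) q w ≤ Nk := by
      intro q w
      have hsplit : klTowerInput L M β U μ K d k = klTowerInput L M β U μ K d (k - 1) + klTowerIncr L M β U μ K d (k - 1) := by
        have h := klTowerInput_succ (L := L) (M := M) β U μ K d (k - 1)
        rwa [show k - 1 + 1 = k by omega] at h
      rw [hsplit]
      refine (klWtPinnedSumAt_add_le hβ.le μ K _ j _ _ _ q w).trans (add_le_add ?_ ?_)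
      · exact (klWtPinnedSumAt_le_klWtPinnedSumOf hβ.le μ K hdk1j (2 * 3) _ q w).trans (hV q w)
      · have h := hΔ q w
        rwa [show (5 - 1 : ℕ) = 2 * 3 - 2 from rfl] at h
    have hmeas : klTowerMeasWtAt L M β U μ K d k j (2 * 3) ≤ Nk := klTowerMeasWtAt_le_of_rows β U μ K d k j (2 * 3) rfl hNk0 hsum
    -- in floor units: the cell term is `C₆·CE³·ε_{dk−1}²/ε_x⁵ ≤ C₆·CE³·λ²/ε_x⁵`, the increment term `≤ C₁j·C₂j⁵·(born/unit one block back) ≤ C₁j·C₂j⁵·A·λ²·Q′³`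
    have hcellU : C₆ * klWtBudget P Qe U (d * k - 1) 6 / klLevUnitF β M 0 3 (d * k - 1) ≤ C₆ * Qe.CE ^ 3 / imagTimeWeight β M ^ 5 * lam ^ 2 := by
      rw [mul_div_assoc, hunit6]
      have hεle : epsCoupling P U (d * k - 1) ^ 2 ≤ lam ^ 2 := pow_le_pow_left₀ (hε0 _) ((hεmono hdk1j).trans hεlam) 2
      calc C₆ * (Qe.CE ^ 3 * epsCoupling P U (d * k - 1) ^ 2 / imagTimeWeight β M ^ 5)
          = C₆ * Qe.CE ^ 3 / imagTimeWeight β M ^ 5 * epsCoupling P U (d * k - 1) ^ 2 := by ring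
        _ ≤ C₆ * Qe.CE ^ 3 / imagTimeWeight β M ^ 5 * lam ^ 2 := mul_le_mul_of_nonneg_left hεle (by positivity)
    have hincU : C₁j * C₂j ^ 5 * ((2 : ℝ) ^ (d * k - 1 - d * (k - 1))) ^ (2 * 3 - 2) * klTowerBornWtAt L M β U μ K d (k - 1) j (2 * 3) /
        klLevUnitF β M 0 3 (d * k - 1) ≤ C₁j * C₂j ^ 5 * (A * Q' ^ 3) * lam ^ 2 := by
      have hj1 := jumpW_mul_div_klLevUnitF_le (M := M) hβ hJle (le_refl 3) hborn0
      have hih : klTowerBornWtAt L M β U μ K d (k - 1) j (2 * 3) / klLevUnitF β M 0 3 (d * (k - 1)) ≤ A * lam ^ 2 * Q' ^ 3 :=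
        ih k hk2 le_rfl 3 le_rfl hD3
      calc C₁j * C₂j ^ 5 * ((2 : ℝ) ^ (d * k - 1 - d * (k - 1))) ^ (2 * 3 - 2) * klTowerBornWtAt L M β U μ K d (k - 1) j (2 * 3) /
            klLevUnitF β M 0 3 (d * k - 1)
          = C₁j * C₂j ^ 5 * (((2 : ℝ) ^ (d * k - 1 - d * (k - 1))) ^ (2 * 3 - 2) * klTowerBornWtAt L M β U μ K d (k - 1) j (2 * 3) /
              klLevUnitF β M 0 3 (d * k - 1)) := by ring
        _ ≤ C₁j * C₂j ^ 5 * (klTowerBornWtAt L M β U μ K d (k - 1) j (2 * 3) / klLevUnitF β M 0 3 (d * (k - 1))) :=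
            mul_le_mul_of_nonneg_left hj1 (by positivity)
        _ ≤ C₁j * C₂j ^ 5 * (A * lam ^ 2 * Q' ^ 3) := mul_le_mul_of_nonneg_left hih (by positivity)
        _ = C₁j * C₂j ^ 5 * (A * Q' ^ 3) * lam ^ 2 := by ring
    have hdivN : klTowerMeasWtAt L M β U μ K d k j (2 * 3) / klLevUnitF β M 0 3 (d * k - 1) ≤
        (C₁j * C₂j ^ 5 * (A * Q' ^ 3) + C₆ * Qe.CE ^ 3 / imagTimeWeight β M ^ 5) * lam ^ 2 := by
      refine (div_le_div_of_nonneg_right hmeas hu1.le).trans ?_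
      rw [hNk, add_div]
      refine (add_le_add hcellU hincU).trans (le_of_eq ?_)
      ring
    calc W * Z ^ 3 * (klTowerMeasWtAt L M β U μ K d k j (2 * 3) / klLevUnitF β M 0 3 (d * k - 1))
        ≤ W * Z ^ 3 * ((C₁j * C₂j ^ 5 * (A * Q' ^ 3) + C₆ * Qe.CE ^ 3 / imagTimeWeight β M ^ 5) * lam ^ 2) :=
          mul_le_mul_of_nonneg_left hdivN (by positivity)
      _ = W * Z ^ 3 * (C₁j * C₂j ^ 5 * (A * Q' ^ 3) + C₆ * Qe.CE ^ 3 / imagTimeWeight β M ^ 5) * lam ^ 2 := by ring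
      _ ≤ ι₃ * lam ^ 2 := mul_le_mul_of_nonneg_right hdom₂ (pow_nonneg hlam.le 2)
  -- W1′ (the kit's induction with the six-leg bridge)
  exact klTowerBornWtAt_le_law_of_inputs_base_tokX_six hβ U μ K j d Kb D hD3 hA hlam hQ.le hW0.le hZ0.le hA'0 hQ'0 hσ0 hΦ0 hψ0 hτ0
    (Zk := fun k => hubbardEffPartitionFnCT L M β U μ 0 K (klScale klE0 (d * k)) ≠ 0) hbase hR hι₁ hι₂ hι₃base hR3 hZ1 hZsucc hstep
    hx₁ hx₂ hx₃ hy hθ hu₁ hu₂ hclose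

end Summit.HubbardSuperconductivity.HubbardSuperconductivity.Theorems.EngineV8

end
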